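import Summits.QuantumFields.BalabanUV.T4Continuum.Spine.NE3.QbarTowerB8
import Summits.QuantumFields.BalabanUV.T4Continuum.Spine.NE3.PairFrameCondition
import HarnessLib

/-!
# Support | NE7 (gen 96, ROAD-G96 §7, brick (Γ2)): AT NE7's PAIR THE TOP DOUBLE-BAR FIELD IS AN EXACT TOP PURE GAUGE —
# for a CORNER-TRIVIAL representative `U′^{u} = U_s·e^{X}` of a competitor with the SAME plain top average `D`,
# `U̿′^{k}(b) = (D^{v⁻¹})(b)·D(b)⁻¹` with `v = vcov L U_s (relPert U_s X) k` the accumulated frame, and `logCovIter … k (b) = log((D^{v⁻¹})(b)·D(b)⁻¹)` in the [B7]-Prop-4 regime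

Cell `pub-balaban`, rung (B)+1 sub-cell t4, lineage `b2b-balaban-t4-ne7-p1` (CRUX PROVER NE7 #1 = OWNER of row NE7), generation 96; memo `t4/b2b-balaban-t4-ne7-p1-g96/ROAD-G96.md`
§7(b)∕(d)(Γ2).  Over row NE3's pair bookkeeping BY NAME: `NE3.PairFrameCondition.avgIter_eq_of_rep` ((92)∕(159)∘(11)), `gaugeAct_inv_gaugeAct`, `dbar_iff_stab` (the solved
form at a pair is `NE3.QbarTowerB8Budget.dbavgCovIter_eq_of_rep_pair`, re-derived here in the corner-trivial case to keep the import cone small), `NE3.QbarDictionary.relPert_eq_expCfg_adField`, `NE3.QbarTowerB8.logCovIter_succ_eq_mlog_dbavgCovIter`, `B7Eq123General.dbavgCovIter_eq_expCfg_logCovIter`.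

WHY.  ROAD-Γ for the NE7 record's last per-pair binder `hdecomp♭` (memo §7): the linearised top average of the slice representative `X₀` splits as
`Qbar_top X₀ = Ad_{Ū}⁻¹(logCovIter_top) + (k-free quadratic ℓ¹∕ℓ² remainder)` — the remainder is (Γ1) (`NE7QbarIterL1DbarFree` p733556 ✓, `NE7QbarIterL2DbarFree` p733763 ✓) — and
THIS FILE identifies the first term at NE7's pair: because the residual representative is corner-trivial (`ResidualSliceRepT.cornerTrivial`: `u(L^{k}z) = 1`) and both configurations
carry the datum `D`, the top double-bar configuration is the exact pure gauge of the ACCUMULATED FRAME `v` relative to `D`, hence its logarithm — the top nonlinear double-bar field —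
is a TOP PURE GAUGE: the dS-invisible, log-dangerous part of the second-order response isolated by gen 96's numerics (kit j333900–2: ≥ 99.5% of the worst case).  The successor's
supplier removes it by the top-corner gauge adjustment `u ↦ u·ṽ` ((Γ4)) instead of booking it in the energy letters.
WHAT ([folklore]; 0 def, 0 sorry).  §1 `uLev_inv_eq_one_of_cornerTrivial` (corner-trivial `u` ⇒ `(u⁻¹)_k = 1`); **`dbavgCovIter_top_eq_frameGauge`**: `rep` + corner-triviality + the two
`avgIter … k = D` ⟹ `dbavgCovIter L W (expCfg (Ad_W X)) k z κ = (D^{v⁻¹})(z,κ)·D(z,κ)⁻¹`, `v = vcov L W (relPert W X) k`; `dbar_iff_frame_stab_of_cornerTrivial` ((1.37) ⟺ `D^{v} = D`).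
§2 **`logCovIter_top_eq_mlog_frameGauge`**: in the [B7]-Prop-4 regime at `W` (the hypotheses of (Γ1): `pdev W < α₀(L^{j+1})⁻²`, `C0·α₀ ≤ 1∕3`, `4α₀ ≤ c2′`, `sup‖X‖ ≤ b`, the
`hsmall`∕`hc₃` lines) the top composite `logCovIter L W (Ad_W X) (j+1) z κ` EQUALS `mlog((D^{v⁻¹})(z,κ)·D(z,κ)⁻¹)`.
HONEST FRAMING (page 1): group algebra and one regime dictionary over landed theorems; nothing of Bałaban's asserted; (Γ3)∕(Γ4)∕(Γ5), `hdecomp♭`, NE7, NE3 NOT proved; spine 0∕9;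
finite T⁴ rung (B)+1 — NOT infinite volume, NOT mass gap, NOT `BetaPertH`, NOT Clay.  Continuum YM on T⁴ ⇐ BetaPertH ∧ nine spine estimates (0/9 proved); BetaPertH ⇐ (D1) ∧ (D4) ∧
CAP+tail; G-an2-4 gates asym, D1 and NE2/3/4.
-/

set_option autoImplicit false

open scoped BigOperators Matrix Matrix.Norms.L2Operator
open NormedSpace

namespace Summit.QuantumFields.BalabanUV.T4Continuum.NE7TopDbarFieldAtPair

open Literature.MathematicalPhysics.QuantumFieldTheory.Balaban1983to89
open B7Prop1Explicit B7Prop2Explicit B7Prop3Flat MatrixLog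
open T4AveragingDeficitWall (Ad IsUnitaryCfg vary)
open B7AvgGaugeCovariance (uLev)
open B7Eq92Concrete (vcov dbavgCovIter)
open B7Prop4GeneralLevels (logCovIter linCovIter)
open B7Eq123General (dbavgCovIter_eq_expCfg_logCovIter)
open NE3.PairLandauB8Avg (relPert)
open NE3.QbarDictionary (adField relPert_eq_expCfg_adField)
open NE3.QbarTowerB8 (logCovIter_succ_eq_mlog_dbavgCovIter)
open NE3.PairFrameCondition (avgIter_eq_of_rep gaugeAct_inv_gaugeAct dbar_iff_stab)

noncomputable section

variable {d : ℕ} {n : Type*} [Fintype n] [DecidableEq n]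

/-! ## §1 Corner-trivial representatives: the coarse frame gauge is the accumulated frame alone -/

/-- A CORNER-TRIVIAL site gauge (`u(L^{k}•z) = 1` for all `z`) has trivial inverse corner values: `uLev L u⁻¹ k = 1`. [folklore] -/
theorem uLev_inv_eq_one_of_cornerTrivial (L k : ℕ) {u : Site d → (Matrix n n ℂ)ˣ}
    (hcorner : ∀ z : Site d, u (((L : ℤ) ^ k) • z) = 1) : uLev L u⁻¹ k = 1 := by
  funext z
  show u⁻¹ (((L : ℤ) ^ k) • z) = 1
  rw [Pi.inv_apply, hcorner z, inv_one]

/-- **THE TOP DOUBLE-BAR CONFIGURATION OF A CORNER-TRIVIAL REPRESENTATIVE AT A PAIR WITH COMMON AVERAGE IS THE PURE GAUGE OF THE ACCUMULATED FRAME**: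
`U_A^{u} = W·e^{X}`, `u(L^{k}•z) = 1`, `Ū_A^{k} = D = W̄^{k}` ⟹ `U̿′^{k}(z,κ) = (D^{v⁻¹})(z,κ)·D(z,κ)⁻¹`, `v = vcov L W (relPert W X) k` ([Balaban1985Averaging] (159)∘(11) at the pair,
row NE3's `dbavgCovIter_eq_of_rep_pair`, with `(u⁻¹)_k = 1`). [folklore] -/
theorem dbavgCovIter_top_eq_frameGauge (L k : ℕ) {u : Site d → (Matrix n n ℂ)ˣ} {UA W D : Site d → Fin d → (Matrix n n ℂ)ˣ}
    {X : Site d → Fin d → Matrix n n ℂ} (hrep : gaugeAct u UA = vary W X 1) (hcorner : ∀ z : Site d, u (((L : ℤ) ^ k) • z) = 1)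
    (hA : avgIter L UA k = D) (hW : avgIter L W k = D) (z : Site d) (κ : Fin d) :
    dbavgCovIter L W (expCfg (adField W X)) k z κ
      = gaugeAct (vcov L W (relPert W X) k)⁻¹ D z κ * (D z κ)⁻¹ := by
  -- (92)∕(159)∘(11): `Ū_A^k = (U̿′^k · W̄^k)^{g}`, `g = (u⁻¹)_k · v_k = v_k` for a corner-trivial `u`; solve for `U̿′^k` at the pair
  have h := avgIter_eq_of_rep L k hrep
  rw [uLev_inv_eq_one_of_cornerTrivial L k hcorner, one_mul, hA, hW] at h
  have h2 := congrArg (gaugeAct (vcov L W (relPert W X) k)⁻¹) h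
  rw [gaugeAct_inv_gaugeAct] at h2
  -- `h2 : (D^{v⁻¹}) = U̿′ · D`
  have h3 := congrFun (congrFun h2 z) κ
  rw [Pi.mul_apply, Pi.mul_apply] at h3
  rw [← relPert_eq_expCfg_adField, h3, mul_inv_cancel_right]

/-- **(1.37) FOR A CORNER-TRIVIAL REPRESENTATIVE AT A PAIR ⟺ THE ACCUMULATED FRAME STABILISES THE DATUM**: `U̿′^{k} = 1 ↔ D^{v} = D` (row NE3's `dbar_iff_stab` with
`(u⁻¹)_k = 1`). [folklore] -/
theorem dbar_iff_frame_stab_of_cornerTrivial (L k : ℕ) {u : Site d → (Matrix n n ℂ)ˣ} {UA W D : Site d → Fin d → (Matrix n n ℂ)ˣ}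
    {X : Site d → Fin d → Matrix n n ℂ} (hrep : gaugeAct u UA = vary W X 1) (hcorner : ∀ z : Site d, u (((L : ℤ) ^ k) • z) = 1)
    (hA : avgIter L UA k = D) (hW : avgIter L W k = D) :
    dbavgCovIter L W (relPert W X) k = 1 ↔ gaugeAct (vcov L W (relPert W X) k) D = D := by
  have h := dbar_iff_stab L k hrep hA hW
  rwa [uLev_inv_eq_one_of_cornerTrivial L k hcorner, one_mul] at h

/-! ## §2 In the [B7]-Prop-4 regime the top composite is the logarithm of that pure gauge -/

/-- **THE TOP NONLINEAR DOUBLE-BAR FIELD AT NE7's PAIR IS THE LOGARITHM OF A TOP PURE GAUGE**: in the regime of [Balaban1985Averaging] Prop. 4 at `W` (the hypotheses of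
`NE7QbarIterL1DbarFree`∕`…L2DbarFree`: `0 < α₀`, `C0·α₀ ≤ 1∕3`, `4α₀ ≤ c2′`, `pdev W < α₀(L^{j+1})⁻²`, `sup‖X‖ ≤ b`, the `hsmall` and `hc₃` lines; `W` unitary), for a corner-trivial
representative at a pair with common `(j+1)`-fold average `D`:
`logCovIter L W (Ad_W X) (j+1) z κ = mlog((D^{v⁻¹})(z,κ)·D(z,κ)⁻¹)`, `v = vcov L W (relPert W X) (j+1)`.  Hence the field subtracted in (Γ1) is `Ad_{Ū}⁻¹` of the logarithm of an
EXACT top pure gauge — removable by the gauge adjustment `u ↦ u·ṽ` at the top corners, invisible to `dS`. [folklore] -/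
theorem logCovIter_top_eq_mlog_frameGauge [Nonempty n] {L : ℕ} (hL : 2 ≤ L) (j : ℕ) {u : Site d → (Matrix n n ℂ)ˣ}
    {UA W D : Site d → Fin d → (Matrix n n ℂ)ˣ} (hWu : IsUnitaryCfg W) {X : Site d → Fin d → Matrix n n ℂ}
    (hrep : gaugeAct u UA = vary W X 1) (hcorner : ∀ z : Site d, u (((L : ℤ) ^ (j + 1)) • z) = 1)
    (hA : avgIter L UA (j + 1) = D) (hW : avgIter L W (j + 1) = D)
    {α₀ b : ℝ} (hα : 0 < α₀) (hα3 : C0 d * α₀ ≤ 1 / 3) (hα4 : 4 * α₀ ≤ c2' d L)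
    (h52 : pdev W < α₀ * (((L : ℝ) ^ (j + 1))⁻¹) ^ 2) (hb : 0 ≤ b) (hX : ∀ (y : Site d) (κ : Fin d), ‖X y κ‖ ≤ b)
    (hsmall : Real.exp (4 * (800 * ((d : ℝ) + 1) ^ 2 * ((d : ℝ) + 4)) * α₀)
      * (1 + 8 * (131072 * ((d : ℝ) + 1) ^ 2) * ((L : ℝ) ^ (j + 1) * b)) ≤ 2)
    (hc₃ : 2 * ((L : ℝ) ^ (j + 1) * b) ≤ c3 d L) (z : Site d) (κ : Fin d) :
    logCovIter L W (adField W X) (j + 1) z κ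
      = mlog ((gaugeAct (vcov L W (relPert W X) (j + 1))⁻¹ D z κ * (D z κ)⁻¹ : (Matrix n n ℂ)ˣ) : Matrix n n ℂ) := by
  letI : CStarAlgebra (Matrix n n ℂ) := {}
  have hG := avgClosed_unitaryUnits d (𝔸 := Matrix n n ℂ) L
  have hU₀ : ∀ (y : Site d) (κ : Fin d), W y κ ∈ unitaryUnits (Matrix n n ℂ) := hWu
  -- the start-framed field has the same sup as `X`
  have hBsup : ∀ (y : Site d) (κ : Fin d), ‖adField W X y κ‖ ≤ b := fun y κ => by
    unfold adField; rw [AveragingDeficitTransport.norm_Ad_of_unitary (hWu y κ)]; exact hX y κ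
  -- the `j`-th double-bar average of `e^{Ad X}` is the exponential of the `j`-th composite (Prop. 4's regime)
  have hQ := dbavgCovIter_eq_expCfg_logCovIter L hL hG (j + 1) W hU₀ hα hα3 hα4 h52 (adField W X) hb hBsup hsmall hc₃
  rw [logCovIter_succ_eq_mlog_dbavgCovIter L W (adField W X) j (hQ j (by omega)),
    dbavgCovIter_top_eq_frameGauge L (j + 1) hrep hcorner hA hW z κ]

end

end Summit.QuantumFields.BalabanUV.T4Continuum.NE7TopDbarFieldAtPair
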